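import Literature.NumberTheory.GaloisCohomology.RestrictedRamificationH3MuOfSUnits
import Literature.NumberTheory.GaloisRepresentations.ContinuousCohomologyFiniteTwoDevissage
import Literature.NumberTheory.GaloisRepresentations.SUnitsRestrictedCohomologyDegreeTwoTorsionFinite
import HarnessLib

/-!
# `H²(U, μ_p)` is FINITE for every open `U ≤ G_{K,S}` fixing `μ_p` (`K` totally complex, `S ⊇ S_p` finite):
# the Kummer sequence of the `S`-units with `H¹(U, E_S)` finite and `H²(U, E_S)[p]` finite
# (Neukirch–Schmidt–Wingberg (8.3.11) ⟹ (8.3.20); Milne ADT I §4, proof of Cor. 4.15)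

Topic `NumberTheory/GaloisCohomology`; namespace `Literature.NumberTheory.GaloisCohomology`.  THEOREMS ONLY (no
definition, no named fact, no `sorry`, no instance; D-0026).  Lane «TATE-EPC-TC» of cell `bsd-eis` (crux
`GoodLatticeBDPValue`, stmt-BirchSwinnertonDyer-19032; road memo `TATE-EPC-TC-ROAD-w5g7.md`, ROUTING #5 brick (B1a)):
hypothesis (ii) `h2` of -w7 g9's dévissage `ContinuousRep.finite_continuousCohomology_two_of_isPrimaryTorsion`
(`ContinuousCohomologyFiniteTwoDevissage`) at `G = G_{K,S}`, `L = μ_p`, for `K` totally complex.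

SETTING: `K` a number field, `S ∋ (v ∣ p)` a set of finite places, `G_{K,S} = Γ_K ⧸ N_S`, `E_S = 𝒪_{K_S,S}ˣ`
(`SUnits.sUnitsRestricted K S`), `ρ₀` a `G_{K,S}`-module structure on `μ_p = μ_p(K̄)` lifting the Galois action,
`U ≤ G_{K,S}` OPEN fixing `μ_p`, `D := E_S|_U`.

* §1 `finite_of_finite_range_of_ker_le_range` — counting through `α → β → γ`: `β` is finite if `α` and the range
  of `β → γ` are finite and `ker ⊆ im`.
* §2 `finite_continuousCohomology_two_torsionBy_of_finite` — Greenberg's sequence (5) for a `π`-divisible discrete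
  `Γ`-module `D`, `Γ` compact: `H²(Γ, D[π])` is finite when `H¹(Γ, D)` and `H²(Γ, D)[π]` are.
* §3 **`finite_continuousCohomology_two_mu_of_sUnits`** — the KUMMER STEP with its two arithmetic inputs as
  hypotheses: if `H¹(U, D)` is finite and `{y ∈ H²(U, D) | p • y = 0}` is finite then `H²(U, μ_p|_U)` is finite.
  Greenberg's sequence (5) for the `p`-divisible `D` (`SUnits.zsmul_surjective_sUnitsRestricted`):
  `H¹(U, D) →δ₁ H²(U, D[p]) → H²(U, D)[p] → 0` (`IsSES.exists_δ₁_eq_of_map_two_eq_zero`,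
  `ContinuousRep.range_Hmap_torsionBy_eq_torsionBy_H`), and `D[p] = E_S[p] ≅ μ_p|_U` are both trivial
  `U`-modules of order `p` (`SUnits.natCard_torsionBy_sUnitsRestricted`, `SUnits.sUnitsRestricted_apply_eq_self_of_mem_torsionBy`,
  transport `ContinuousRep.nonempty_continuousCohomology_addEquiv_of_trivial_of_card_eq`).
* §4 **`finite_continuousCohomology_two_mu_of_isTotallyComplex`** — at a TOTALLY COMPLEX `K` with `S ⊇ S_p` FINITE the
  two inputs are the lane's (F1b) `SUnits.Layers.finite_continuousCohomology_one_resRep` (`H¹(U, E_S)` finite,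
  NSW (8.3.11) (ii)) and (F2b) `SUnits.Layers.finite_torsion_continuousCohomology_two_resRep` (`H²(U, E_S)[p]` finite,
  NSW (8.3.11) (ii)/(iii)), after writing `U = galoisGroupAbove S (π⁻¹ U)`; so
  `Finite (continuousCohomology 2 (ρ₀.restrict (subgroupIncl U)).toTopRep)` — token for token hypothesis `h2` of the
  dévissage at `G_{K,S}`.

HONEST FRAMING: one step of a textbook proof (NSW (8.3.20) / Milne I 4.15 for `μ_p` over open subgroups, totally
complex base) assembled from the lane's bricks; the named fact `finite_restrictedCohomology K` itself is closed in the
sequel `RestrictedRamificationFiniteCohomologyTotallyComplex` (with -w3 g15's reduction); no statement of a Summit, not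
Tate's Euler-characteristic formula, not the crux is proved here; 0 cells / labels / tiers move.  Cell `bsd-eis`, lane «TATE-EPC-TC»: seats -w2 g8/g9, -w3 g15, -w4 g16/g17,
-w5 g7, -w6 g9, -w7 g9, -w8 g9/g10 of line `x1-p1`.

## References
* J. Neukirch, A. Schmidt, K. Wingberg, *Cohomology of Number Fields*, 2nd ed. (2008), (8.3.11) (ii)/(iii), (8.3.20) and
  the proof of (8.3.18). [NeukirchSchmidtWingberg2008]
* J. S. Milne, *Arithmetic Duality Theorems*, 2nd ed. (2006), I §4 (Thm. 4.10, Lemma 4.14, Cor. 4.15). [MilneADT2006]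
* R. Greenberg, *On the structure of certain Galois cohomology groups*, Doc. Math. Extra Vol. Coates (2006), §3 B (5).
  [Greenberg2006]
* D. Harari, *Galois Cohomology and Class Field Theory* (2020), §17.4 Lemma 17.21, Cor. 17.17. [Harari2020]
-/

noncomputable section

open CategoryTheory Function NumberField Field IsDedekindDomain Topology
open scoped NumberField

namespace Literature.NumberTheory.GaloisCohomology

open Literature.NumberTheory.GaloisRepresentations
open Literature.NumberTheory.GaloisRepresentations.DiscreteGaloisModule (mu MuCarrier mu_apply_apply)
open Literature.NumberTheory.GaloisRepresentations.SUnits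
open Literature.NumberTheory.IwasawaTheory.Greenberg2016 (Hmap)
open Literature.NumberTheory.IwasawaTheory.Greenberg2006 (galoisGroupAbove)
open _root_.TopRep _root_.ContRepresentation _root_.ContinuousCohomology

variable {K : Type} [Field K] [NumberField K]

/-! ### §1. Counting through `α → β → γ` -/

/-- If `φ : α → β`, `ψ : β → γ` are additive with `ker ψ ⊆ im φ`, `α` finite and the range of `ψ` finite, then `β`
is finite. [cite: MilneADT2006, I §4 (proof of Cor. 4.15)] -/
theorem finite_of_finite_range_of_ker_le_range {α β γ : Type*} [AddCommGroup α] [AddCommGroup β]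
    [AddCommGroup γ] [Finite α] (φ : α →+ β) (ψ : β →+ γ) (hψ : (Set.range ψ).Finite)
    (h : ∀ b, ψ b = 0 → ∃ a, φ a = b) : Finite β := by
  classical
  haveI : Finite ψ.range := by
    have e : (ψ.range : Set γ) = Set.range ψ := AddMonoidHom.coe_range ψ
    exact (e ▸ hψ).to_subtype
  haveI := Fintype.ofFinite α
  haveI := Fintype.ofFinite ψ.range
  haveI : Fintype β := AddGroup.fintypeOfKerLeRange φ ψ.rangeRestrict fun b hb => by
    rw [AddMonoidHom.ker_rangeRestrict, AddMonoidHom.mem_ker] at hb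
    obtain ⟨a, ha⟩ := h b hb
    exact ⟨a, ha⟩
  exact Finite.of_fintype β

/-! ### §2. Greenberg's sequence (5): `H²(Γ, D[π])` finite from `H¹(Γ, D)` finite and `H²(Γ, D)[π]` finite -/

section Generic

universe u

variable {Λ : Type u} [CommRing Λ] [TopologicalSpace Λ]
variable {Γ : Type u} [Group Γ] [TopologicalSpace Γ] [IsTopologicalGroup Γ] [CompactSpace Γ]
variable {D : Type u} [AddCommGroup D] [Module Λ D] [TopologicalSpace D] [DiscreteTopology D] [ContinuousSMul Λ D]

/-- **`H²(Γ, D[π])` is finite when `H¹(Γ, D)` and `H²(Γ, D)[π]` are**, for a `π`-divisible discrete `Γ`-module `D`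
(`Γ` compact): Greenberg's sequence (5) `H¹(Γ, D) →δ₁ H²(Γ, D[π]) → H²(Γ, D)[π] → 0` — exactness at `H²(Γ, D[π])`
(`IsSES.exists_δ₁_eq_of_map_two_eq_zero`) and the image (`ContinuousRep.range_Hmap_torsionBy_eq_torsionBy_H`).
[cite: Greenberg2006, §3 B (5) p. 360] [cite: MilneADT2006, I §4 Cor. 4.15 (proof)] -/
theorem finite_continuousCohomology_two_torsionBy_of_finite (ρ : ContinuousRep Γ Λ D) (π : Λ)
    (hπ : Function.Surjective fun d : D ↦ π • d) (h1 : Finite (continuousCohomology 1 ρ.toTopRep))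
    (h2 : (Submodule.torsionBy Λ (ρ.H 2) π : Set (ρ.H 2)).Finite) :
    Finite (continuousCohomology 2
      (ρ.subrepresentation (Submodule.torsionBy Λ D π) (ρ.torsionBy_smul_le_comap π)).toTopRep) := by
  let ρ₁ := ρ.subrepresentation (Submodule.torsionBy Λ D π) (ρ.torsionBy_smul_le_comap π)
  let ι : ρ₁.toTopRep ⟶ ρ.toTopRep :=
    TopRep.ofHom ⟨(Submodule.torsionBy Λ D π).subtypeL, fun g ↦ by ext m; rfl⟩
  let μ : ρ.toTopRep ⟶ ρ.toTopRep := TopRep.ofHom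
    { toLinearMap := DistribSMul.toLinearMap Λ D π
      cont := continuous_of_discreteTopology
      isIntertwining' := fun g ↦ by
        ext d
        change π • ρ g d = ρ g (π • d)
        rw [(ρ g).map_smul] }
  have hμ : ∀ d : D, μ.hom d = π • d := fun _ ↦ rfl
  have hSES : IsSES ι μ := ρ.isSES_torsionBy_smul π hπ ι (fun _ ↦ rfl) μ hμ
  have hrange := ρ.range_Hmap_torsionBy_eq_torsionBy_H π hπ 2
  haveI := h1
  refine finite_of_finite_range_of_ker_le_range hSES.δ₁.toAddMonoidHom
    (cohomologyMap ι 2).hom.toLinearMap.toAddMonoidHom (h2.subset ?_) fun z hz =>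
    hSES.exists_δ₁_eq_of_map_two_eq_zero z hz
  rintro _ ⟨x, rfl⟩
  exact (SetLike.ext_iff.1 hrange
    (Hmap ρ₁ ρ (Submodule.torsionBy Λ D π).subtypeL (fun _ _ ↦ rfl) 2 x)).1 ⟨x, rfl⟩

end Generic

/-! ### §3. `H²(U, μ_p)` finite from `H¹(U, D)` finite and `H²(U, D)[p]` finite, `D = E_S|_U` -/

/-- **THE KUMMER STEP FOR `H²(U, μ_p)`** (NSW (8.3.20) from (8.3.11); Milne I Cor. 4.15, proof): `K` a number field,
`S ∋ (v ∣ p)`, `ρ₀` a `G_{K,S}`-module structure on `μ_p` lifting the Galois action, `U ≤ G_{K,S}` open with `ρ₀|_U`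
trivial, `D := E_S|_U`.  If `H¹(U, D)` is finite and `{y ∈ H²(U, D) | p • y = 0}` is finite, then `H²(U, μ_p)` is
finite: `H²(U, D[p])` is finite (§2, `D` is `p`-divisible) and `D[p] = E_S[p] ≅ μ_p|_U`, both trivial of order `p`.
[cite: NeukirchSchmidtWingberg2008, (8.3.11), (8.3.20) (proof)] [cite: MilneADT2006, I §4 Cor. 4.15 (proof)]
[cite: Greenberg2006, §3 B (5) p. 360] -/
theorem finite_continuousCohomology_two_mu_of_sUnits (S : Set (HeightOneSpectrum (𝓞 K))) (p : ℕ) [Fact p.Prime]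
    (hSp : ∀ v : HeightOneSpectrum (𝓞 K), ((p : ℕ) : 𝓞 K) ∈ v.asIdeal → v ∈ S)
    (ρ₀ : ContinuousRep (GaloisGroupUnramifiedOutside K S) ℤ (MuCarrier K p))
    (hρ₀ : ∀ (σ : absoluteGaloisGroup K) (v : MuCarrier K p), ρ₀ (toUnramifiedQuot K S σ) v = mu K p σ v)
    (U : Subgroup (GaloisGroupUnramifiedOutside K S)) (hU : IsOpen (U : Set (GaloisGroupUnramifiedOutside K S)))
    (hfix : ∀ g ∈ U, ∀ v : MuCarrier K p, ρ₀ g v = v)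
    (hfin1 : Finite (continuousCohomology 1 ((sUnitsRestricted K S).restrict (subgroupIncl U)).toTopRep))
    (htors : {y : continuousCohomology 2 ((sUnitsRestricted K S).restrict (subgroupIncl U)).toTopRep |
      p • y = 0}.Finite) :
    Finite (continuousCohomology 2 (ρ₀.restrict (subgroupIncl U)).toTopRep) := by
  classical
  haveI hp : Fact p.Prime := inferInstance
  haveI : NeZero p := ⟨hp.out.ne_zero⟩
  haveI : NeZero ((p : ℕ) : AlgebraicClosure K) := ⟨Nat.cast_ne_zero.2 hp.out.ne_zero⟩
  haveI := AlgebraicClosure.hasEnoughRootsOfUnity K p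
  haveI : TotallyDisconnectedSpace (GaloisGroupUnramifiedOutside K S) :=
    Literature.GroupTheory.ProfiniteSubquotients.totallyDisconnectedSpace_quotient
      (ramificationSubgroup K S) (ramificationSubgroup_isClosed K S)
  haveI : CompactSpace U := isCompact_iff_compactSpace.mp (Subgroup.isClosed_of_isOpen U hU).isCompact
  -- `D = E_S|_U`, `p`-divisible; `D[p]`
  let D := (sUnitsRestricted K S).restrict (subgroupIncl U)
  have hπ : Function.Surjective fun d : Representation.invariants
      ((sUnitsModule K S).toRepresentation.comp (ramificationSubgroup K S).subtype) ↦ (p : ℤ) • d :=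
    zsmul_surjective_sUnitsRestricted K S hSp
  let ρ₁ := D.subrepresentation (Submodule.torsionBy ℤ _ (p : ℤ)) (D.torsionBy_smul_le_comap (p : ℤ))
  -- `H²(U, D[p])` is finite (§2; the `ℕ`- and `ℤ`-torsion conditions on `H²(U, D)` agree)
  have hfinρ₁ : Finite (continuousCohomology 2 ρ₁.toTopRep) := by
    refine finite_continuousCohomology_two_torsionBy_of_finite D (p : ℤ) hπ hfin1 (htors.subset fun y hy => ?_)
    have hy' := (@Submodule.mem_torsionBy_iff ℤ (D.H 2) _ _ (ContinuousRep.H.instModule D 2) (p : ℤ) y).1 hy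
    have e := @Nat.cast_smul_eq_nsmul ℤ (D.H 2) _ _ (ContinuousRep.H.instModule D 2) p y
    exact e.symm.trans hy'
  -- `D[p] = E_S[p]` and `μ_p|_U` are both trivial `U`-modules of order `p`
  have hcard₁ : Nat.card (Submodule.torsionBy ℤ (Representation.invariants
      ((sUnitsModule K S).toRepresentation.comp (ramificationSubgroup K S).subtype)) (p : ℤ)) = p :=
    natCard_torsionBy_sUnitsRestricted K S hSp
  have hcard₂ : Nat.card (MuCarrier K p) = p := by
    change Nat.card (rootsOfUnity p (AlgebraicClosure K)) = p
    exact HasEnoughRootsOfUnity.natCard_rootsOfUnity _ p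
  haveI : Finite (Submodule.torsionBy ℤ (Representation.invariants
      ((sUnitsModule K S).toRepresentation.comp (ramificationSubgroup K S).subtype)) (p : ℤ)) :=
    Nat.finite_of_card_ne_zero (by rw [hcard₁]; exact hp.out.ne_zero)
  haveI : Finite (MuCarrier K p) := Nat.finite_of_card_ne_zero (by rw [hcard₂]; exact hp.out.ne_zero)
  have htriv₁ : ∀ (g : U) (a : Submodule.torsionBy ℤ (Representation.invariants
      ((sUnitsModule K S).toRepresentation.comp (ramificationSubgroup K S).subtype)) (p : ℤ)),
      ρ₁ g a = a := fun g a => by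
    obtain ⟨σ, hσ⟩ := toUnramifiedQuot_surjective K S (g : GaloisGroupUnramifiedOutside K S)
    have hσfix : ∀ v : MuCarrier K p, ρ₀ (toUnramifiedQuot K S σ) v = v := fun v => by
      rw [hσ]
      exact hfix _ g.2 v
    apply Subtype.ext
    change sUnitsRestricted K S (g : GaloisGroupUnramifiedOutside K S) (a : _) = a
    rw [← hσ]
    exact sUnitsRestricted_apply_eq_self_of_mem_torsionBy K S
      (smul_rootsOfUnity_eq_of_apply_eq ρ₀ hρ₀ hσfix) a.2
  have htriv₂ : ∀ (g : U) (v : MuCarrier K p), ρ₀.restrict (subgroupIncl U) g v = v :=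
    fun g v => hfix g.1 g.2 v
  obtain ⟨e⟩ := ContinuousRep.nonempty_continuousCohomology_addEquiv_of_trivial_of_card_eq ρ₁
    (ρ₀.restrict (subgroupIncl U)) htriv₁ htriv₂ hcard₁ hcard₂ 2
  haveI := hfinρ₁
  exact Finite.of_equiv _ e.toEquiv

/-! ### §4. `H²(U, μ_p)` is finite at a totally complex `K`, `S ⊇ S_p` finite -/

/-- **`H²(U, μ_p)` IS FINITE** for every open `U ≤ G_{K,S}` fixing `μ_p`, `K` TOTALLY COMPLEX, `S ⊇ S_p` FINITE — the
hypothesis (ii) of the dévissage `ContinuousRep.finite_continuousCohomology_two_of_isPrimaryTorsion` at `G_{K,S}`,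
`L = μ_p`.  The Kummer step (§2) fed with the lane's (F1b) `H¹(U, E_S)` finite and (F2b) `H²(U, E_S)[p]` finite
(`U = galoisGroupAbove S (π⁻¹ U)`). [cite: NeukirchSchmidtWingberg2008, (8.3.11) (ii)/(iii), (8.3.20)]
[cite: MilneADT2006, I §4 Cor. 4.15] -/
theorem finite_continuousCohomology_two_mu_of_isTotallyComplex [IsTotallyComplex K]
    (S : Set (HeightOneSpectrum (𝓞 K))) (hSf : S.Finite) (p : ℕ) [Fact p.Prime]
    (hSp : ∀ v : HeightOneSpectrum (𝓞 K), ((p : ℕ) : 𝓞 K) ∈ v.asIdeal → v ∈ S)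
    (ρ₀ : ContinuousRep (GaloisGroupUnramifiedOutside K S) ℤ (MuCarrier K p))
    (hρ₀ : ∀ (σ : absoluteGaloisGroup K) (v : MuCarrier K p), ρ₀ (toUnramifiedQuot K S σ) v = mu K p σ v)
    (U : Subgroup (GaloisGroupUnramifiedOutside K S)) (hU : IsOpen (U : Set (GaloisGroupUnramifiedOutside K S)))
    (hfix : ∀ g ∈ U, ∀ v : MuCarrier K p, ρ₀ g v = v) :
    Finite (continuousCohomology 2 (ρ₀.restrict (subgroupIncl U)).toTopRep) := by
  -- `U = galoisGroupAbove S H` for the open `H := π⁻¹(U) ⊇ N_S`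
  obtain ⟨H, hHo, hNS, rfl⟩ : ∃ H : Subgroup (absoluteGaloisGroup K),
      IsOpen (H : Set (absoluteGaloisGroup K)) ∧ ramificationSubgroup K S ≤ H ∧ galoisGroupAbove S H = U :=
    ⟨U.comap (toUnramifiedQuot K S), hU.preimage (continuous_toUnramifiedQuot K S),
      fun σ hσ => by
        rw [Subgroup.mem_comap]
        have h1 : toUnramifiedQuot K S σ = 1 := (QuotientGroup.eq_one_iff σ).2 hσ
        rw [h1]
        exact U.one_mem,
      Subgroup.map_comap_eq_self_of_surjective (toUnramifiedQuot_surjective K S) U⟩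
  exact finite_continuousCohomology_two_mu_of_sUnits S p hSp ρ₀ hρ₀ (galoisGroupAbove S H) hU hfix
    (SUnits.Layers.finite_continuousCohomology_one_resRep hHo hNS hSf)
    (SUnits.Layers.finite_torsion_continuousCohomology_two_resRep hHo hNS hSf (Fact.out : p.Prime).pos)

end Literature.NumberTheory.GaloisCohomology

end
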